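import Summits.ResolutionOfSingularities.ResolutionOfSingularities.Theorems.PurelyInseparableDim4ChartAtlasSNCRepairGlobal
import HarnessLib

/-!
# Purely inseparable four-folds `z^p + F(x₁, …, x₄)`: the BOUNDARY DICTIONARY on the shear charts of the S3-N1 atlas — how the old
# boundary members read on the chart `x_l` (brick S3-N2 support; cell `res-dim4-pi`, typ-2 g5)

[OURS · counted 0] (D-0157 DOOR 2; DR-157-C; desk WORD #115 (a) (S3-N2) «the shape of the OLD boundary members at the added points»; typ-3
g4 K-20a «packages against `M.boundary = E`»). On the cover chart `x_l` of the S3-N1 atlas the re-centring is the SHEAR `Θ` (E1: `Θ z = z + g`,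
`Θ|_{K[x]} = τ`, `τ x_j = x_j`, `τ x_l = x_l`, `τ xᵢ = xᵢ + bᵢ x_j` on `S ∖ {j, l}`, `τ x_k = x_k + b_k` off `S`). For a boundary member of the
PARENT stage reading a (translated) coordinate hyperplane on the parent's chart — typ-3's shape datum `(idx, cst)` — its STRICT TRANSFORM under
ANY blowing up `π : W → 𝔸⁵` along `V(z, x_S)` reads on `φ_l = Spec Θ ≫ chartImm_l` as follows. PROVED here (no `sorry`, no new axiom):

* `comap_shear_chart_strictTransform_translate` — `idx = i ∉ S`: `(xᵢ + (bᵢ + cst))·𝒪` (translated coordinate hyperplane);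
* `comap_shear_chart_strictTransform_hyperplane_shear` — `idx = i ∈ S ∖ {j, l}` (`cst = 0`): **`(xᵢ + bᵢ·x_j)·𝒪` — SHEARED** when `bᵢ ≠ 0`;
* `comap_shear_chart_strictTransform_hyperplane_j` — `idx = j`: `x_j·𝒪` (on the `x_j`-chart this member is EMPTY, here it is not);
* `comap_shear_chart_strictTransform_hyperplane_self` — `idx = l`: `⊤` (empty on the `x_l`-chart);
and E2's `comap_shear_chart_exceptional`: the new exceptional component reads `x_l·𝒪`.

With these, a v3 member can COUNT the bad set `B = {x_j·𝒪 if {x_j = 0} is an old member through the centre} ∪ {(x_m + b_m x_j)·𝒪 : m ∈ T,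
b_m ≠ 0}` of the S3-N2 dichotomy (p690374/p690709 negative, p691155/p692862 positive) mechanically from the parent's shape data. Nothing here is a
statement about resolution of singularities in dimension ≥ 4 / characteristic `p` (NOT proved anywhere in this programme). bears_on:
LADDER-RESOLUTION:D157-DOOR2 (res-dim4-pi). Supports stmt-ResolutionOfSingularities-16155 (helper, S3-N2 boundary dictionary).
-/

-- every declaration of this summit lives under `Summit.ResolutionOfSingularities.ResolutionOfSingularities`
-- (summit = problem), which the duplicate-namespace linter flags; house convention (cf. the Target file).
set_option linter.dupNamespace false

noncomputable section

open MvPolynomial Finset CategoryTheory AlgebraicGeometry Opposite TopologicalSpace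
open AlgebraicGeometry.Scheme.IdealSheafData (ofIdealTop vanishingIdeal)

namespace Summit.ResolutionOfSingularities.ResolutionOfSingularities.Theorems.PIDim4

open Literature.AlgebraicGeometry.Resolution
open Literature.AlgebraicGeometry.Resolution.AffinePointBlowup (P A γ coord Wtop ξ)

namespace ChartDictionary

variable {K : Type} [Field K] {S : Finset (Fin 4)} {j l : Fin 4} {b : Fin 4 → K}
  {Θ : A 4 K ≃ₐ[K] A 4 K} {τ : MvPolynomial (Fin 4) K ≃ₐ[K] MvPolynomial (Fin 4) K} {g : MvPolynomial (Fin 4) K}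
  {W : Scheme.{0}} {π : W ⟶ P 4 K}

/-- **A transversal old member (`idx = i ∉ S`, constant `cst`) reads `(xᵢ + (bᵢ + cst))·𝒪` on the shear chart `x_l`.** -/
theorem comap_shear_chart_strictTransform_translate (hl : l ∈ S) {i : Fin 4} (hi : i ∉ S) (cst : K)
    (hτ : ∀ k : Fin 4, Θ (X k.succ) = rename Fin.succ (τ (X k))) (hτi : τ (X i) = X i + C (b i))
    (hπ : IsBlowup π (AffineCoordBlowup.𝓘Λ 4 K (insert 0 (Fin.succ '' (S : Set (Fin 4)))))) :
    (strictTransformIdeal π (AffineCoordBlowup.𝓘Λ 4 K (insert 0 (Fin.succ '' (S : Set (Fin 4)))))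
        (ofIdealTop (Ideal.span {(γ 4 K).symm (X i.succ + C cst)}))).comap
        (Spec.map (CommRingCat.ofHom (Θ : A 4 K →+* A 4 K)) ≫ AffineCoordBlowup.chartImm hπ (succ_mem_centreVars hl)) =
      ofIdealTop (Ideal.span {(γ 4 K).symm (X i.succ + C (b i + cst))}) := by
  have hC : Θ (C cst) = C cst := Θ.commutes cst
  have hΘ : Θ (X i.succ + C cst) = X i.succ + C (b i + cst) := by
    rw [map_add, hτ i, hτi, hC, map_add, rename_X, rename_C, map_add, add_assoc]
  rw [Scheme.IdealSheafData.comap_comp, strictTransformIdeal_translate_comap_chartImm hl hi cst hπ, comap_ofIdealTop_span_γ_symm,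
    RingHom.coe_coe, hΘ]

/-- **An old member through the centre, `idx = i ∈ S ∖ {j, l}`, reads `(xᵢ + bᵢ·x_j)·𝒪` on the shear chart `x_l` — SHEARED when `bᵢ ≠ 0`**
(the point `b` of the `x_j`-chart was OFF this member; the local walk dropped it, the global centre still meets it). -/
theorem comap_shear_chart_strictTransform_hyperplane_shear (hl : l ∈ S) {i : Fin 4} (hil : i ≠ l)
    (hτ : ∀ k : Fin 4, Θ (X k.succ) = rename Fin.succ (τ (X k))) (hτi : τ (X i) = X i + C (b i) * X j)
    (hπ : IsBlowup π (AffineCoordBlowup.𝓘Λ 4 K (insert 0 (Fin.succ '' (S : Set (Fin 4)))))) :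
    (strictTransformIdeal π (AffineCoordBlowup.𝓘Λ 4 K (insert 0 (Fin.succ '' (S : Set (Fin 4)))))
        (ofIdealTop (Ideal.span {coord 4 K i.succ}))).comap
        (Spec.map (CommRingCat.ofHom (Θ : A 4 K →+* A 4 K)) ≫ AffineCoordBlowup.chartImm hπ (succ_mem_centreVars hl)) =
      ofIdealTop (Ideal.span {(γ 4 K).symm (X i.succ + C (b i) * X j.succ)}) := by
  have hΘ : Θ (X i.succ) = X i.succ + C (b i) * X j.succ := by
    rw [hτ i, hτi, map_add, map_mul, rename_X, rename_C, rename_X]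
  rw [Scheme.IdealSheafData.comap_comp, strictTransformIdeal_hyperplane_comap_chartImm hl hil hπ,
    show coord 4 K i.succ = (γ 4 K).symm (X i.succ) from rfl, comap_ofIdealTop_span_γ_symm, RingHom.coe_coe, hΘ]

/-- **The old member `{x_j = 0}` (`idx = j`), invisible on the `x_j`-chart, reads `x_j·𝒪` on the shear chart `x_l`** (`τ x_j = x_j`). -/
theorem comap_shear_chart_strictTransform_hyperplane_j (hl : l ∈ S) (hjl : j ≠ l)
    (hτ : ∀ k : Fin 4, Θ (X k.succ) = rename Fin.succ (τ (X k))) (hτj : τ (X j) = X j)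
    (hπ : IsBlowup π (AffineCoordBlowup.𝓘Λ 4 K (insert 0 (Fin.succ '' (S : Set (Fin 4)))))) :
    (strictTransformIdeal π (AffineCoordBlowup.𝓘Λ 4 K (insert 0 (Fin.succ '' (S : Set (Fin 4)))))
        (ofIdealTop (Ideal.span {coord 4 K j.succ}))).comap
        (Spec.map (CommRingCat.ofHom (Θ : A 4 K →+* A 4 K)) ≫ AffineCoordBlowup.chartImm hπ (succ_mem_centreVars hl)) =
      ofIdealTop (Ideal.span {(γ 4 K).symm (X j.succ)}) := by
  have hΘ : Θ (X j.succ) = X j.succ := by rw [hτ j, hτj, rename_X]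
  rw [Scheme.IdealSheafData.comap_comp, strictTransformIdeal_hyperplane_comap_chartImm hl hjl hπ,
    show coord 4 K j.succ = (γ 4 K).symm (X j.succ) from rfl, comap_ofIdealTop_span_γ_symm, RingHom.coe_coe, hΘ]

/-- **The old member `{x_l = 0}` (`idx = l`) is EMPTY on the chart `x_l`.** -/
theorem comap_shear_chart_strictTransform_hyperplane_self (hl : l ∈ S) (Θ' : A 4 K →+* A 4 K)
    (hπ : IsBlowup π (AffineCoordBlowup.𝓘Λ 4 K (insert 0 (Fin.succ '' (S : Set (Fin 4)))))) :
    (strictTransformIdeal π (AffineCoordBlowup.𝓘Λ 4 K (insert 0 (Fin.succ '' (S : Set (Fin 4)))))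
        (ofIdealTop (Ideal.span {coord 4 K l.succ}))).comap
        (Spec.map (CommRingCat.ofHom Θ') ≫ AffineCoordBlowup.chartImm hπ (succ_mem_centreVars hl)) = ⊤ := by
  rw [Scheme.IdealSheafData.comap_comp, strictTransformIdeal_hyperplane_self_comap_chartImm hl hπ, Scheme.IdealSheafData.comap_top]

end ChartDictionary

end Summit.ResolutionOfSingularities.ResolutionOfSingularities.Theorems.PIDim4

end
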